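import Summits.BirchSwinnertonDyer.BirchSwinnertonDyer.Theorems.AlignedTransportAtTwoMainConjectureOfRankZeroBSDAtTwoCubicOffStratumPrimes
import HarnessLib

/-!
# Route `AlignedTransportAtTwo`, crux C2 `MainConjectureOfRankZeroBSDAtTwo` (stmt-BirchSwinnertonDyer-22298):
# PRIMES WITH `e = f = 1` ⟺ EMBEDDINGS INTO `ℚ_p` (the converse half), and THE FULL COUNT: the cubic `2`-torsion field of a
# good-ordinary seed-cell curve has EXACTLY `3` primes above `2` ON the Kilford stratum and EXACTLY `2` OFF it

HONEST FRAMING (cell `bsd-f1-sign2`, WIDTH-5 attached prover seat `bsd-line-att-p5` gen 26 on line `birth` of the lead `bsd-line-att-p2`;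
`--supports` stmt-BirchSwinnertonDyer-22298, closes nothing; BSD is NOT proved by any of this; the crux C2, its verdict «blocked-on
`Rank1Residual.GreenbergMuConjectureIrreducible`» and every registered stub are untouched). THEOREMS ONLY — no definition, no named fact,
no `sorry`. Sequel of this gen's `…CubicKilfordPrimes` (ON ⟹ three primes) and `…CubicOffStratumPrimes` (§1: an `e = f = 1` prime IS an
embedding `F → ℚ_p`; OFF ⟹ at most two primes).

WHAT.
* §1 (any number field `F`, any prime `p`) `mem_iff_norm_lt_one_of_valuation_iff` (the valuation-ring dictionary of
  `…AlignedTransportAtTwoBridge.exists_heightOneSpectrum_of_ringHom_padic` in membership form); **`inertiaDeg_eq_one_of_ringHom_padic`** and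
  **`ramificationIdx_eq_one_of_ringHom_padic`**: the prime `v = {r : ‖σ r‖_p < 1}` cut out by a ring map `σ : F → ℚ_p` has `f(v|p) = 1`
  (`𝓞 F / v ↪ ℤ_p / p`, so `N(v) ≤ p`) and `e(v|p) = 1` (`p ∈ v²` would give `p ∈ p²ℤ_p`); with `…CubicOffStratumPrimes` §1 this is the
  equivalence **`exists_ringHom_padic_iff`**: `(∃ σ : F → ℚ_p, v = {‖σ ·‖ < 1}) ⟺ p ∈ v ∧ e(v|p) = 1 ∧ f(v|p) = 1` (Neukirch: `F_v = ℚ_p`).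
* §2 (cubic fields of the `u`-cubic) **`two_le_ncard_of_isOrdinaryAt_two`**: `V/ℚ` globally minimal, good ORDINARY at `2`, `E_V(ℚ)[2] = 0`, `F`
  a cubic field with a root of `c_V` ⟹ AT LEAST TWO primes above `2` in `F` (the canonical odd-unit root of `c_V` in `ℤ₂` is an embedding whose
  prime has `e f = 1`, and `Σ eᵢfᵢ = 3` leaves room for another prime); **`ncard_eq_two_of_not_onKilfordStratumAtTwo`** (OFF the stratum:
  EXACTLY two); **`ncard_eq_three_or_eq_two`** — THE COUNT: `#{v ∣ 2} = 3` if `Δ_min ≡ 1 (mod 8)`, `= 2` otherwise.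

Nothing is asserted about any seed; nothing is closed; BSD is not proved.

References: [NeukirchANT1999] Ch. II §8 (8.1)–(8.3), Ch. I §8 Prop. (8.2); [Serre1973] Ch. II §3.3 Thm. 4; [SilvermanAEC2009] III.1, VII.2; tree:
g26 `…CubicKilfordPrimes` (p746875) / `…CubicOffStratumPrimes`, g16 `…PadicLetterOnPointsPrimes`, g14 `…AlignedTransportAtTwoBridge`,
`…KilfordStratum` (`exists_padicInt_root_of_isOrdinaryAt_two`).
-/

set_option linter.dupNamespace false
set_option autoImplicit false

noncomputable section

open scoped Classical NumberField nonZeroDivisors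

namespace Summit.BirchSwinnertonDyer.BirchSwinnertonDyer.Theorems.AlignedTransportAtTwoCubicPrimesOfEmbeddings

open NumberField IsDedekindDomain Polynomial WeierstrassCurve IntermediateField
  Literature.NumberTheory.EllipticCurves Literature.NumberTheory.EllipticCurves.Greenberg1999
  Summit.BirchSwinnertonDyer.Rank1Residual.F1Sign2
  Summit.BirchSwinnertonDyer.BirchSwinnertonDyer.Theorems.AlignedTransportAtTwoBridge
  Summit.BirchSwinnertonDyer.BirchSwinnertonDyer.Theorems.AlignedTransportAtTwoFineRoad.RealKummerLinesPadicLetterOnPointsPrimes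
  Summit.BirchSwinnertonDyer.BirchSwinnertonDyer.Theorems.AlignedTransportAtTwoKilfordStratumShared
  Summit.BirchSwinnertonDyer.BirchSwinnertonDyer.Theorems.AlignedTransportAtTwoKilfordStratum
  Summit.BirchSwinnertonDyer.BirchSwinnertonDyer.Theorems.AlignedTransportAtTwoCubicLayerOneDoors
  Summit.BirchSwinnertonDyer.BirchSwinnertonDyer.Theorems.AlignedTransportAtTwoCubicKilfordPrimes
  Summit.BirchSwinnertonDyer.BirchSwinnertonDyer.Theorems.AlignedTransportAtTwoCubicOffStratumPrimes

/-! ## §1 The prime cut out by an embedding `F → ℚ_p` has `e = f = 1` -/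

section Converse

variable {F : Type*} [Field F] [NumberField F] {p : ℕ} [Fact p.Prime]

/-- The valuation-ring dictionary `v(a) ≤ 1 ⟺ ‖σ a‖ ≤ 1` (all `a ∈ F`) in MEMBERSHIP form on `𝓞 F`: `r ∈ v ⟺ ‖σ r‖_p < 1`.
[cite: NeukirchANT1999, Ch. II §8 (8.1)] -/
theorem mem_iff_norm_lt_one_of_valuation_iff (σ : F →+* ℚ_[p]) (v : HeightOneSpectrum (𝓞 F))
    (hv : ∀ a : F, v.valuation F a ≤ 1 ↔ ‖σ a‖ ≤ 1) (r : 𝓞 F) :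
    r ∈ v.asIdeal ↔ ‖σ (algebraMap (𝓞 F) F r)‖ < 1 := by
  have key : ∀ a : F, v.valuation F a < 1 ↔ ‖σ a‖ < 1 := by
    intro a
    by_cases h0 : a = 0
    · rw [h0, map_zero, map_zero, norm_zero]; exact ⟨fun _ => zero_lt_one, fun _ => zero_lt_one⟩
    have hva : 0 < v.valuation F a := zero_lt_iff.mpr ((Valuation.ne_zero_iff _).mpr h0)
    have hσa : 0 < ‖σ a‖ := norm_pos_iff.mpr ((map_ne_zero σ).mpr h0)
    have hinv := hv a⁻¹
    rw [map_inv₀, map_inv₀, norm_inv, inv_le_one₀ hva, inv_le_one₀ hσa] at hinv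
    constructor
    · intro h; by_contra h'; exact absurd (hinv.mpr (not_lt.mp h')) (not_le.mpr h)
    · intro h; by_contra h'; exact absurd (hinv.mp (not_lt.mp h')) (not_le.mpr h)
  exact (v.valuation_lt_one_iff_mem (K := F) r).symm.trans (key _)

omit [NumberField F] in
/-- `p ∈ v` for the prime cut out by `σ` (`‖p‖_p < 1`). [folklore] -/
theorem natCast_mem_of_ringHom_padic (σ : F →+* ℚ_[p]) (v : HeightOneSpectrum (𝓞 F))
    (hv : ∀ r : 𝓞 F, r ∈ v.asIdeal ↔ ‖σ (algebraMap (𝓞 F) F r)‖ < 1) : (p : 𝓞 F) ∈ v.asIdeal := by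
  rw [hv, map_natCast, map_natCast]; exact Padic.norm_p_lt_one

/-- **The prime cut out by `σ : F → ℚ_p` has residue degree `1`**: `r ↦ σ r mod p` induces an injection `𝓞 F / v ↪ ℤ_p / p = 𝔽_p`, so
`N(v) = p^f ≤ p`. [cite: NeukirchANT1999, Ch. II §8, (8.2)–(8.3)] -/
theorem inertiaDeg_eq_one_of_ringHom_padic (σ : F →+* ℚ_[p]) (v : HeightOneSpectrum (𝓞 F))
    (hv : ∀ r : 𝓞 F, r ∈ v.asIdeal ↔ ‖σ (algebraMap (𝓞 F) F r)‖ < 1) : v.asIdeal.inertiaDeg ℤ = 1 := by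
  classical
  have hp : p.Prime := Fact.out
  have hpv := natCast_mem_of_ringHom_padic σ v hv
  haveI := liesOver_span_of_natCast_mem p v hpv
  haveI : (Ideal.span {(p : ℤ)}).IsMaximal := Int.ideal_span_isMaximal_of_prime p
  haveI : v.asIdeal.IsMaximal := v.isMaximal
  -- `σ` maps `𝓞 F` into `ℤ_p`
  have hint : ∀ r : 𝓞 F, ‖σ (algebraMap (𝓞 F) F r)‖ ≤ 1 := fun r => norm_ringHom_ringOfIntegers_le_one σ r
  let ψ : 𝓞 F →+* ℤ_[p] := (σ.comp (algebraMap (𝓞 F) F)).codRestrict (PadicInt.subring p) hint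
  have hψ : ∀ r : 𝓞 F, ((ψ r : ℤ_[p]) : ℚ_[p]) = σ (algebraMap (𝓞 F) F r) := fun r => rfl
  -- `r ∈ v ↔ toZMod (ψ r) = 0`
  have hker : ∀ r : 𝓞 F, PadicInt.toZMod (ψ r) = 0 ↔ r ∈ v.asIdeal := fun r => by
    rw [← RingHom.mem_ker, PadicInt.ker_toZMod, PadicInt.maximalIdeal_eq_span_p, Ideal.mem_span_singleton,
      ← PadicInt.norm_lt_one_iff_dvd, hv r, PadicInt.norm_def, hψ]
  -- the induced injection `𝓞 F / v ↪ ZMod p`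
  have hle : v.asIdeal ≤ RingHom.ker (PadicInt.toZMod.comp ψ) := fun r hr => by
    rw [RingHom.mem_ker, RingHom.comp_apply]; exact (hker r).mpr hr
  have hinj : Function.Injective (Ideal.Quotient.lift v.asIdeal (PadicInt.toZMod.comp ψ) hle) := by
    rw [injective_iff_map_eq_zero]
    intro x hx
    obtain ⟨r, rfl⟩ := Ideal.Quotient.mk_surjective x
    rw [Ideal.Quotient.lift_mk, RingHom.comp_apply] at hx
    exact Ideal.Quotient.eq_zero_iff_mem.mpr ((hker r).mp hx)
  have hfin : Finite (𝓞 F ⧸ v.asIdeal) := Ideal.finiteQuotientOfFreeOfNeBot _ v.ne_bot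
  have hcard : Nat.card (𝓞 F ⧸ v.asIdeal) ≤ p := by
    have := Nat.card_le_card_of_injective _ hinj
    rwa [Nat.card_zmod] at this
  -- `N(v) = p ^ f ≤ p`
  rw [← Submodule.cardQuot_apply, ← Ideal.absNorm_apply, Ideal.absNorm_eq_pow_inertiaDeg' v.asIdeal hp,
    Ideal.inertiaDeg'_eq_inertiaDeg (Ideal.span {(p : ℤ)}) v.asIdeal] at hcard
  have hfpos : 0 < v.asIdeal.inertiaDeg ℤ := Ideal.inertiaDeg_pos v.asIdeal ℤ
  by_contra hne
  have h2 : 2 ≤ v.asIdeal.inertiaDeg ℤ := by omega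
  have : p ^ 2 ≤ p := (Nat.pow_le_pow_right hp.pos h2).trans hcard
  nlinarith [hp.two_le]

/-- **The prime cut out by `σ : F → ℚ_p` is unramified (`e = 1`)**: `p ∈ v`, and `p ∈ v²` is impossible since `σ(v) ⊆ pℤ_p` would put `p`
in `p²ℤ_p`. [cite: NeukirchANT1999, Ch. II §8, (8.2)–(8.3)] -/
theorem ramificationIdx_eq_one_of_ringHom_padic (σ : F →+* ℚ_[p]) (v : HeightOneSpectrum (𝓞 F))
    (hv : ∀ r : 𝓞 F, r ∈ v.asIdeal ↔ ‖σ (algebraMap (𝓞 F) F r)‖ < 1) : v.asIdeal.ramificationIdx ℤ = 1 := by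
  classical
  have hp : p.Prime := Fact.out
  have hpv := natCast_mem_of_ringHom_padic σ v hv
  haveI := liesOver_span_of_natCast_mem p v hpv
  haveI : v.asIdeal.IsPrime := v.isPrime
  have h0 : (Ideal.span {(p : ℤ)} : Ideal ℤ) ≠ ⊥ := by
    rw [Ne, Ideal.span_singleton_eq_bot]; exact_mod_cast hp.ne_zero
  have hmap : (Ideal.span {(p : ℤ)}).map (algebraMap ℤ (𝓞 F)) = Ideal.span {(p : 𝓞 F)} := by
    rw [Ideal.map_span, Set.image_singleton, map_natCast]
  -- `σ` maps `𝓞 F` into `ℤ_p`, and `v` into `pℤ_p`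
  have hint : ∀ r : 𝓞 F, ‖σ (algebraMap (𝓞 F) F r)‖ ≤ 1 := fun r => norm_ringHom_ringOfIntegers_le_one σ r
  let ψ : 𝓞 F →+* ℤ_[p] := (σ.comp (algebraMap (𝓞 F) F)).codRestrict (PadicInt.subring p) hint
  have hψ : ∀ r : 𝓞 F, ((ψ r : ℤ_[p]) : ℚ_[p]) = σ (algebraMap (𝓞 F) F r) := fun r => rfl
  have hvle : v.asIdeal ≤ Ideal.comap ψ (Ideal.span {(p : ℤ_[p])}) := fun r hr => by
    rw [Ideal.mem_comap, Ideal.mem_span_singleton, ← PadicInt.norm_lt_one_iff_dvd, PadicInt.norm_def, hψ]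
    exact (hv r).mp hr
  -- `e = 1`: `(p) ≤ v` and `¬ (p) ≤ v²`
  rw [← Ideal.ramificationIdx'_eq_ramificationIdx (Ideal.span {(p : ℤ)}) v.asIdeal h0]
  refine Ideal.ramificationIdx'_spec ?_ ?_
  · rw [hmap, pow_one, Ideal.span_singleton_le_iff_mem]; exact hpv
  · rw [hmap, Ideal.span_singleton_le_iff_mem]
    intro hp2
    have h1 : (p : 𝓞 F) ∈ Ideal.comap ψ (Ideal.span {(p : ℤ_[p])} ^ 2) :=
      (Ideal.le_comap_pow ψ 2) (Ideal.pow_right_mono hvle 2 hp2)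
    rw [Ideal.mem_comap, map_natCast, Ideal.span_singleton_pow, Ideal.mem_span_singleton] at h1
    obtain ⟨c, hc⟩ := h1
    have hp0 : (p : ℤ_[p]) ≠ 0 := by exact_mod_cast hp.ne_zero
    have hpc : (p : ℤ_[p]) * c = 1 := by
      apply mul_left_cancel₀ hp0
      rw [mul_one, ← mul_assoc, ← sq]; exact hc.symm
    have hu : IsUnit (p : ℤ_[p]) := IsUnit.of_mul_eq_one c hpc
    have hlt : ‖(p : ℤ_[p])‖ < 1 := by
      rw [PadicInt.norm_p]; exact inv_lt_one_of_one_lt₀ (by exact_mod_cast hp.one_lt)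
    exact absurd (PadicInt.isUnit_iff.mp hu) (ne_of_lt hlt)

/-- **PRIMES WITH `e = f = 1` ⟺ EMBEDDINGS INTO `ℚ_p`** (Neukirch: `F_v = ℚ_p` iff `e(v|p) = f(v|p) = 1`), in the kernel's completion-free
form: a height-one prime `v` of `𝓞 F` is cut out by some ring map `σ : F → ℚ_p` (`v = {r : ‖σ r‖_p < 1}`) iff `p ∈ v`, `e(v|p) = 1` and
`f(v|p) = 1` (⟸ is `…CubicOffStratumPrimes.exists_ringHom_padic_of_ramificationIdx_eq_one_of_inertiaDeg_eq_one`).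
[cite: NeukirchANT1999, Ch. II §8, (8.1)–(8.3)] -/
theorem exists_ringHom_padic_iff (v : HeightOneSpectrum (𝓞 F)) :
    (∃ σ : F →+* ℚ_[p], ∀ r : 𝓞 F, r ∈ v.asIdeal ↔ ‖σ (algebraMap (𝓞 F) F r)‖ < 1) ↔
      (p : 𝓞 F) ∈ v.asIdeal ∧ v.asIdeal.ramificationIdx ℤ = 1 ∧ v.asIdeal.inertiaDeg ℤ = 1 :=
  ⟨fun ⟨σ, hσ⟩ => ⟨natCast_mem_of_ringHom_padic σ v hσ, ramificationIdx_eq_one_of_ringHom_padic σ v hσ,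
    inertiaDeg_eq_one_of_ringHom_padic σ v hσ⟩,
    fun ⟨hpv, he, hf⟩ => exists_ringHom_padic_of_ramificationIdx_eq_one_of_inertiaDeg_eq_one v hpv he hf⟩

end Converse

/-! ## §2 The count of primes above `2` in the cubic `2`-torsion field of a good-ordinary curve -/

section Cubic

variable (F : Type) [Field F] [NumberField F] (V : WeierstrassCurve ℚ) [V.IsElliptic] [V.IsGloballyMinimal]

/-- **AT LEAST TWO PRIMES ABOVE `2`, always** (good ordinary at `2`, `E_V(ℚ)[2] = 0`, `F` cubic with a root `e₁` of `c_V`): the canonical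
odd-unit root of `c_V` in `ℤ₂` (Hensel) gives an embedding `F → ℚ₂`, whose prime has `e = f = 1` (§1); the fundamental identity
`Σ eᵢfᵢ = 3` then forces a second prime above `2`. [cite: NeukirchANT1999, Ch. I §8 Prop. (8.2) and Ch. II §8] [cite: SilvermanAEC2009, VII.2] -/
theorem two_le_ncard_of_isOrdinaryAt_two (hord : IsOrdinaryAt V 2) (ht : ∀ x : ℚ, ¬ HasRationalTwoTorsionX V x)
    (hF : Module.finrank ℚ F = 3) {e₁ : F} (he₁ : aeval e₁ (twoDivisionUCubic V) = 0) :
    2 ≤ {v : HeightOneSpectrum (𝓞 F) | ((2 : ℕ) : 𝓞 F) ∈ v.asIdeal}.ncard := by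
  classical
  -- the canonical root and its embedding
  obtain ⟨y, -, hy⟩ := exists_padicInt_root_of_isOrdinaryAt_two V hord
  have hmin : minpoly ℚ e₁ = twoDivisionUCubic V := minpoly_eq_twoDivisionUCubic V ht he₁
  obtain ⟨pb, hgen, -⟩ := exists_powerBasis_gen_eq (natDegree_twoDivisionUCubic V) hF hmin
  have hroot : aeval (y : ℚ_[2]) (minpoly ℚ pb.gen) = 0 := by rw [hgen, hmin]; exact hy
  set σ : F →ₐ[ℚ] ℚ_[2] := pb.lift (y : ℚ_[2]) hroot with hσ
  obtain ⟨v₁, hv₁2, hv₁⟩ := exists_heightOneSpectrum_of_ringHom_padic (σ : F →+* ℚ_[2])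
  have hv₁' : ∀ r : 𝓞 F, r ∈ v₁.asIdeal ↔ ‖(σ : F →+* ℚ_[2]) (algebraMap (𝓞 F) F r)‖ < 1 :=
    mem_iff_norm_lt_one_of_valuation_iff (σ : F →+* ℚ_[2]) v₁ hv₁
  have he : v₁.asIdeal.ramificationIdx ℤ = 1 := ramificationIdx_eq_one_of_ringHom_padic (σ : F →+* ℚ_[2]) v₁ hv₁'
  have hf : v₁.asIdeal.inertiaDeg ℤ = 1 := inertiaDeg_eq_one_of_ringHom_padic (σ : F →+* ℚ_[2]) v₁ hv₁'
  -- the fundamental identity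
  haveI : (Ideal.span {(2 : ℤ)}).IsMaximal :=
    Ideal.IsPrime.isMaximal ((Ideal.span_singleton_prime two_ne_zero).mpr Int.prime_two) (by simp)
  have h20 : (Ideal.span {(2 : ℤ)} : Ideal ℤ) ≠ ⊥ := by simp
  haveI : v₁.asIdeal.IsPrime := v₁.isPrime
  haveI : v₁.asIdeal.IsMaximal := v₁.isMaximal
  haveI hl₁ : v₁.asIdeal.LiesOver (Ideal.span {(2 : ℤ)}) := liesOver_span_of_natCast_mem 2 v₁ hv₁2
  set S := IsDedekindDomain.primesOverFinset (Ideal.span {(2 : ℤ)}) (𝓞 F) with hSdef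
  have hmemS : v₁.asIdeal ∈ S := (IsDedekindDomain.mem_primesOverFinset_iff h20 _).mpr ⟨v₁.isPrime, hl₁⟩
  have hsum := Ideal.sum_ramification_inertia (R := ℤ) (𝓞 F) ℚ F (p := Ideal.span {(2 : ℤ)}) h20
  rw [hF, ← Finset.add_sum_erase S _ hmemS, Ideal.ramificationIdx'_eq_ramificationIdx (Ideal.span {(2 : ℤ)}) v₁.asIdeal h20,
    Ideal.inertiaDeg'_eq_inertiaDeg (Ideal.span {(2 : ℤ)}) v₁.asIdeal, he, hf, mul_one] at hsum
  -- so some other prime lies over `2`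
  have hne : (S.erase v₁.asIdeal).Nonempty := by
    by_contra h
    rw [Finset.not_nonempty_iff_eq_empty] at h
    rw [h, Finset.sum_empty] at hsum
    omega
  obtain ⟨P, hP⟩ := hne
  obtain ⟨hPne, hPS⟩ := Finset.mem_erase.mp hP
  obtain ⟨hPp, hPl⟩ := (IsDedekindDomain.mem_primesOverFinset_iff h20 _).mp hPS
  have hPbot : P ≠ ⊥ := by
    intro hb
    haveI := hPl
    have : (2 : 𝓞 F) ∈ P := by
      have h2 : (algebraMap ℤ (𝓞 F)) 2 ∈ P :=
        (Ideal.mem_of_liesOver P (Ideal.span {(2 : ℤ)}) 2).mp (Ideal.mem_span_singleton_self 2)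
      simpa using h2
    rw [hb, Ideal.mem_bot] at this
    exact two_ne_zero this
  set v₂ : HeightOneSpectrum (𝓞 F) := ⟨P, hPp, hPbot⟩ with hv₂def
  have hv₂2 : ((2 : ℕ) : 𝓞 F) ∈ v₂.asIdeal := by
    haveI := hPl
    have h2 : (algebraMap ℤ (𝓞 F)) 2 ∈ P :=
      (Ideal.mem_of_liesOver P (Ideal.span {(2 : ℤ)}) 2).mp (Ideal.mem_span_singleton_self 2)
    simpa using h2
  have hne12 : v₁ ≠ v₂ := fun h => hPne (by rw [h])
  -- count
  have hfin : {v : HeightOneSpectrum (𝓞 F) | ((2 : ℕ) : 𝓞 F) ∈ v.asIdeal}.Finite := finite_setOf_two_mem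
  have h2 : ({v₁, v₂} : Set (HeightOneSpectrum (𝓞 F))).ncard = 2 := Set.ncard_pair hne12
  have hsub : ({v₁, v₂} : Set (HeightOneSpectrum (𝓞 F))) ⊆ {v : HeightOneSpectrum (𝓞 F) | ((2 : ℕ) : 𝓞 F) ∈ v.asIdeal} := by
    intro v hv
    simp only [Set.mem_insert_iff, Set.mem_singleton_iff] at hv
    rcases hv with rfl | rfl
    · exact_mod_cast hv₁2
    · exact hv₂2
  calc 2 = ({v₁, v₂} : Set (HeightOneSpectrum (𝓞 F))).ncard := h2.symm
    _ ≤ _ := Set.ncard_le_ncard hsub hfin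

/-- **OFF THE STRATUM: EXACTLY TWO PRIMES ABOVE `2`** in the cubic field (good ordinary at `2`, `E_V(ℚ)[2] = 0`).
[cite: NeukirchANT1999, Ch. II §8, (8.1)–(8.3)] [cite: SilvermanAEC2009, VII.2] -/
theorem ncard_eq_two_of_not_onKilfordStratumAtTwo (hord : IsOrdinaryAt V 2) (ht : ∀ x : ℚ, ¬ HasRationalTwoTorsionX V x)
    (hF : Module.finrank ℚ F = 3) {e₁ : F} (he₁ : aeval e₁ (twoDivisionUCubic V) = 0) (hs : ¬ OnKilfordStratumAtTwo V) :
    {v : HeightOneSpectrum (𝓞 F) | ((2 : ℕ) : 𝓞 F) ∈ v.asIdeal}.ncard = 2 :=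
  le_antisymm (ncard_le_two_of_not_onKilfordStratumAtTwo F V ht hF he₁ hs) (two_le_ncard_of_isOrdinaryAt_two F V hord ht hF he₁)

/-- **THE COUNT.** For `V/ℚ` globally minimal with good ORDINARY reduction at `2` and no rational `2`-torsion abscissa, and `F` any cubic
number field with a root of `c_V` (e.g. `ℚ(x(T))`, `T ∈ E[2] ∖ 0`): the number of primes of `F` above `2` is `3` if `Δ_min(V) ≡ 1 (mod 8)`
and `2` otherwise. [cite: NeukirchANT1999, Ch. II §8, (8.1)–(8.3)] [cite: Serre1973, Ch. II §3.3 Thm. 4] [cite: SilvermanAEC2009, IV.§3 and VII.2] -/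
theorem ncard_eq_three_or_eq_two (hord : IsOrdinaryAt V 2) (ht : ∀ x : ℚ, ¬ HasRationalTwoTorsionX V x)
    (hF : Module.finrank ℚ F = 3) {e₁ : F} (he₁ : aeval e₁ (twoDivisionUCubic V) = 0) :
    (minimalDiscriminantInt V % 8 = 1 ∧ {v : HeightOneSpectrum (𝓞 F) | ((2 : ℕ) : 𝓞 F) ∈ v.asIdeal}.ncard = 3) ∨
      (minimalDiscriminantInt V % 8 ≠ 1 ∧ {v : HeightOneSpectrum (𝓞 F) | ((2 : ℕ) : 𝓞 F) ∈ v.asIdeal}.ncard = 2) := by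
  by_cases h8 : minimalDiscriminantInt V % 8 = 1
  · exact Or.inl ⟨h8, ncard_eq_three_of_onKilfordStratumAtTwo V hord ht
      ((onKilfordStratumAtTwo_iff_minimalDiscriminantInt_emod_eight V hord).mpr h8) hF he₁⟩
  · exact Or.inr ⟨h8, ncard_eq_two_of_not_onKilfordStratumAtTwo F V hord ht hF he₁
      ((not_onKilfordStratumAtTwo_iff_minimalDiscriminantInt_emod_eight_ne V hord).mpr h8)⟩

end Cubic

end Summit.BirchSwinnertonDyer.BirchSwinnertonDyer.Theorems.AlignedTransportAtTwoCubicPrimesOfEmbeddings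

end
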